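import Literature.MathematicalPhysics.QuantumFieldTheory.BalabanImbrieJaffe1984to88.BIJ88GaussIntegration309Law
import Mathlib.Analysis.Calculus.ParametricIntegral
import Mathlib.MeasureTheory.Constructions.BorelSpace.Metrizable

/-!
# `BalabanImbrieJaffe1984to88.BIJ88RestrictionsAllOrders308` — T. Bałaban, J. Imbrie, A. Jaffe, *Effective action and cluster
properties of the abelian Higgs model*, Commun. Math. Phys. **114** (1988) 257–315 [BalabanImbrieJaffe1988]: Sect. 5.14, p. 308 [PDF 52],
*"Thus the restrictions and the interactions disappear at t = 0, at which point we have a purely Gaussian expectation. Thus we define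
perturbative terms for the action, 𝒫_{k+1} = Σ_{α=1}^{n̄} −(1/α!)(dᵅ/dtᵅ) log z_t|_{t=0} …"* with p. 307 *"extremely small factors when a
χ′-factor is replaced by 1"* — ALL t-DERIVATIVES of the expectation of the interpolated restrictions
`z(t) = ∫ χ′_{Λ,t} dμ`, `χ′_{Λ,t} = Π_{b∈B} χ(c_b·p(te_k), Φ_b)`.

statement-level skeleton of published theorems with citation tags; proofs where landed; nothing here is a claim about the Yang–Mills mass gap

ERRATUM (v1.1, docstring only; referee ref-1 gen 27/28, render `lit-balaban-r16/renders/cmp114/original-p052-x2.png`): print's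
(5.14.1) carries a leading MINUS — 𝒫_{k+1}(Λ₁₂^{(k)}) = Σ_{α=1}^{n̄} −(1/α!)(dᵅ/dtᵅ) log z_t(Λ₁₂^{(k)})|_{t=0} — and so does the
remainder (5.14.2), ℛ_k(Λ₁₂^{(k)}) = ∫₀¹ dt −((1−t)^{n̄}/(n̄+1)!)⟨d/dt; …; d/dt⟩_t; the v1 quotation dropped the sign.  Declarations are
unchanged (the minus lives inside `BIJ88Perturbative341.pertPart`).

WHAT THIS FILE ADDS to this seat's p. 308/309 chain (`BIJ88GaussIntegration309Product/Law`: pointwise and integrated bounds for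
(d/dt)ⁿχ′).  The perturbative terms are t-derivatives of EXPECTATIONS at every order `α ≤ n̄`; here, for ANY finite measure and measurable
fields, on the branch `0 < t`, `te_k < e^{−1}`:

* **§1–§2 regularity of the integrand** — `s ↦ (d/ds)ⁿχ′_{Λ,s}(A)` has derivative `(d/ds)^{n+1}χ′_{Λ,s}(A)` on the open branch
  (`hasDerivAt_iteratedDeriv_prod_cutoff_t`), and `ω ↦ (d/dt)ⁿχ′_{Λ,t}(Φ(ω))` is measurable for every `n` (`measurable_iteratedDeriv_prod_cutoff_t`,
  by induction: each derivative is a pointwise limit of measurable difference quotients).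
* **§3 every t-derivative passes under the expectation** — `z` is smooth on the branch and
  `z^{(n)}(t₀) = ∫ (d/dt)ⁿχ′_{Λ,t}|_{t₀} dμ` for EVERY `n` (`hasDerivAt_integral_iteratedDeriv_prod_cutoff_t`,
  `iteratedDeriv_integral_prod_cutoff_t`), with `|z^{(n)}(t₀)| ≤ (NĈ)ⁿ t₀^{−n} Σ_b μ{(9/10)|c_b|p(t₀e_k) ≤ |Φ_b|}`
  (`abs_iteratedDeriv_integral_prod_cutoff_t_le`).
* **§4 the restrictions disappear at `t = 0` TO ALL ORDERS** — for CENTERED Gaussian marginals (any probability space, Mathlib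
  `HasGaussianLaw`, variances `≤ v`, `|c_b| ≥ c₀ > 0`, `p > 1/2`): `|z^{(n)}(t)| ≤ (NĈ)ⁿt^{−n}·2N·e^{−(81/200)(c₀²/v)p(te_k)²}` and hence
  `z^{(n)}(t) → 0` as `t → 0⁺` for every `n ≥ 1` (`tendsto_iteratedDeriv_integral_prod_cutoff_t_zero`; the Gaussian factor beats every power
  of `t`, `tendsto_zpow_mul_exp_neg_pLog_sq`): the restriction factor contributes NOTHING to the Taylor coefficients at `t = 0⁺` — the
  quantitative content of *"extremely small factors when a χ′-factor is replaced by 1"*.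

PDF held: `paper:balaban1988-cmp114-bij-abelian-higgs-effective-action` (journal page = PDF page + 256); pp. 307–309 [PDF 51–53].

CITATION HEADER (lean-in-tree rule).  Part of the lit-balaban TYPED SKELETON (HOME `run/shared/lean/pub/lit-balaban/`), Phase 2,
seat p36 (gen 7, unit `lit-balaban-p36`); rows **C2.Eq5.14.1-5.14.2** / **C2.Eq5.14.3-5.14.4** of `HOME/lit-balaban-r16/ROWS-C2-part2.md`
(owner r16; typed leaves untouched).  Theorems only; no definitions, no `Prop` facts; axioms standard.
-/

namespace Literature.MathematicalPhysics.QuantumFieldTheory.BalabanImbrieJaffe1984to88.BIJ88RestrictionsAllOrders308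

open MeasureTheory ProbabilityTheory Filter Set
open BIJ88Sect2Statements (pLog eK)
open BIJ88Sect5Statements (CutoffProfile cutoff)
open scoped Topology

/-! ## §1 The integrand is smooth in `t` on the open branch: derivatives of all orders -/

section Smooth

variable (χ : CutoffProfile) {ι : Type*}

/-- On the open branch `U = {0 < s, se_k < 1}` the n-th t-derivative of `χ′_{Λ,s}(A)` has derivative the (n+1)-st.
[cite: BalabanImbrieJaffe1988, (5.14.3) p.309] -/
theorem hasDerivAt_iteratedDeriv_prod_cutoff_t (p : ℝ) (B : Finset ι) (A c : ι → ℝ) {ek t : ℝ} (hek : 0 < ek) (ht : 0 < t)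
    (h1 : t * ek < 1) (n : ℕ) :
    HasDerivAt (iteratedDeriv n fun s => ∏ b ∈ B, cutoff χ (c b * pLog p (s * ek)) (A b))
      (iteratedDeriv (n + 1) (fun s => ∏ b ∈ B, cutoff χ (c b * pLog p (s * ek)) (A b)) t) t := by
  set f : ℝ → ℝ := fun s => ∏ b ∈ B, cutoff χ (c b * pLog p (s * ek)) (A b) with hf
  set U : Set ℝ := {s : ℝ | 0 < s ∧ s * ek < 1} with hU
  have hUo : IsOpen U := BIJ88ChiTDerivN309.isOpen_branch ek
  have htU : t ∈ U := ⟨ht, h1⟩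
  have hcd : ContDiffOn ℝ ((n + 1 : ℕ) : ℕ∞) f U :=
    contDiffOn_prod fun b _ => BIJ88GaussIntegration309Product.contDiffOn_cutoff_t χ p (A b) (c b) hek (n + 1)
  have hdiffW : DifferentiableOn ℝ (iteratedDerivWithin n f U) U :=
    hcd.differentiableOn_iteratedDerivWithin (by exact_mod_cast Nat.lt_succ_self n) hUo.uniqueDiffOn
  have hev : iteratedDerivWithin n f U =ᶠ[𝓝 t] iteratedDeriv n f := by
    filter_upwards [hUo.mem_nhds htU] with s hs
    exact iteratedDerivWithin_of_isOpen hUo hs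
  have hda : DifferentiableAt ℝ (iteratedDeriv n f) t :=
    ((hdiffW t htU).differentiableAt (hUo.mem_nhds htU)).congr_of_eventuallyEq hev.symm
  rw [iteratedDeriv_succ]
  exact hda.hasDerivAt

end Smooth

/-! ## §2 Measurability of `ω ↦ (d/dt)ⁿχ′_{Λ,t}(Φ(ω))` for every order -/

section Measurable

variable (χ : CutoffProfile) {ι Ω : Type*} [MeasurableSpace Ω]

/-- For measurable fields and every order `n`, `ω ↦ (d/dt)ⁿ Π_b χ(c_b·p(te_k), Φ_b(ω))|_t` is measurable at every `t` of the open branch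
(induction on `n`: the (n+1)-st derivative is the pointwise limit of difference quotients of the n-th along `t + δ/(k+1)`).
[cite: BalabanImbrieJaffe1988, (5.14.3) p.309] -/
theorem measurable_iteratedDeriv_prod_cutoff_t (p : ℝ) (B : Finset ι) {Φ : ι → Ω → ℝ} (hΦ : ∀ b ∈ B, Measurable (Φ b))
    (c : ι → ℝ) {ek : ℝ} (hek : 0 < ek) (n : ℕ) {t : ℝ} (ht : 0 < t) (h1 : t * ek < 1) :
    Measurable fun ω => iteratedDeriv n (fun s => ∏ b ∈ B, cutoff χ (c b * pLog p (s * ek)) (Φ b ω)) t := by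
  induction n generalizing t with
  | zero =>
    simp only [iteratedDeriv_zero]
    refine Finset.measurable_fun_prod B fun b hb => ?_
    exact χ.smooth.continuous.measurable.comp ((hΦ b hb).div_const _)
  | succ n ih =>
    -- the sequence u k = t + δ/(k+1) inside the branch, δ = (1/e_k − t)/2
    set δ : ℝ := (ek⁻¹ - t) / 2 with hδ
    have htinv : t < ek⁻¹ := by rwa [lt_inv_comm₀ ht hek, inv_eq_one_div, lt_div_iff₀ ht, mul_comm]
    have hδ0 : 0 < δ := by rw [hδ]; linarith
    set u : ℕ → ℝ := fun k => t + δ / ((k : ℝ) + 1) with hu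
    have hu_pos : ∀ k, 0 < u k := fun k => by rw [hu]; positivity
    have hu_gt : ∀ k, t < u k := fun k => by
      rw [hu]; have : 0 < δ / ((k : ℝ) + 1) := by positivity
      linarith
    have hu_lt : ∀ k, u k * ek < 1 := by
      intro k
      have hk1 : (1 : ℝ) ≤ (k : ℝ) + 1 := by have := (Nat.cast_nonneg k : (0 : ℝ) ≤ k); linarith
      have hle : δ / ((k : ℝ) + 1) ≤ δ := div_le_self hδ0.le hk1
      have hut : u k ≤ t + δ := by rw [hu]; linarith
      have : (t + δ) * ek < 1 := by
        have h2 : t + δ < ek⁻¹ := by rw [hδ]; linarith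
        calc (t + δ) * ek < ek⁻¹ * ek := mul_lt_mul_of_pos_right h2 hek
          _ = 1 := inv_mul_cancel₀ hek.ne'
      exact lt_of_le_of_lt (mul_le_mul_of_nonneg_right hut hek.le) this
    have hu_tend : Tendsto u atTop (𝓝[≠] t) := by
      refine tendsto_nhdsWithin_iff.mpr ⟨?_, Filter.Eventually.of_forall fun k => (hu_gt k).ne'⟩
      have h0 : Tendsto (fun k : ℕ => δ / ((k : ℝ) + 1)) atTop (𝓝 0) :=
        tendsto_const_nhds.div_atTop (tendsto_natCast_atTop_atTop.atTop_add tendsto_const_nhds)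
      simpa [hu] using tendsto_const_nhds.add h0
    -- the difference quotients are measurable (induction hypothesis at u k and at t) and converge pointwise
    set g : ℕ → Ω → ℝ := fun k ω =>
      slope (iteratedDeriv n fun s => ∏ b ∈ B, cutoff χ (c b * pLog p (s * ek)) (Φ b ω)) t (u k) with hg
    have hgm : ∀ k, Measurable (g k) := by
      intro k
      have hm1 := ih (hu_pos k) (hu_lt k)
      have hm2 := ih ht h1
      simp only [hg, slope, vsub_eq_sub, smul_eq_mul]
      exact (hm1.sub hm2).const_mul _
    refine measurable_of_tendsto_metrizable hgm (tendsto_pi_nhds.mpr fun ω => ?_)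
    have hd := hasDerivAt_iteratedDeriv_prod_cutoff_t χ p B (fun b => Φ b ω) c hek ht h1 n
    exact (hasDerivAt_iff_tendsto_slope.mp hd).comp hu_tend

end Measurable

/-! ## §3 Every t-derivative passes under the expectation -/

section UnderIntegral

variable (χ : CutoffProfile) {ι Ω : Type*} [MeasurableSpace Ω]

/-- **All orders under the integral sign.**  For ANY finite measure μ, measurable fields, thresholds `c_b ≠ 0`, `0 < e_k`, every order `n`
and `t₀` on the branch `0 < t₀`, `t₀e_k < e^{−1}`: `t ↦ ∫ (d/dt)ⁿχ′_{Λ,t} dμ` has derivative `∫ (d/dt)^{n+1}χ′_{Λ,t}|_{t₀} dμ` at `t₀`, and the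
latter integrand is integrable (dominated on `(t₀/2, e^{−1}/e_k)` by `(NĈ)^{n+1}(t₀/2)^{−(n+1)}`, `BIJ88GaussIntegration309Product`).
[cite: BalabanImbrieJaffe1988, (5.14.3) p.309] -/
theorem hasDerivAt_integral_iteratedDeriv_prod_cutoff_t (p : ℝ) (μ : Measure Ω) [IsFiniteMeasure μ] (B : Finset ι)
    {Φ : ι → Ω → ℝ} (hΦ : ∀ b ∈ B, Measurable (Φ b)) {c : ι → ℝ} (hc : ∀ b ∈ B, c b ≠ 0) {ek t₀ : ℝ} (hek : 0 < ek)
    (ht₀ : 0 < t₀) (h1 : t₀ * ek < Real.exp (-1)) (n : ℕ) :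
    Integrable (fun ω => iteratedDeriv (n + 1) (fun s => ∏ b ∈ B, cutoff χ (c b * pLog p (s * ek)) (Φ b ω)) t₀) μ ∧
      HasDerivAt (fun t => ∫ ω, iteratedDeriv n (fun s => ∏ b ∈ B, cutoff χ (c b * pLog p (s * ek)) (Φ b ω)) t ∂μ)
        (∫ ω, iteratedDeriv (n + 1) (fun s => ∏ b ∈ B, cutoff χ (c b * pLog p (s * ek)) (Φ b ω)) t₀ ∂μ) t₀ := by
  classical
  set s : Set ℝ := Set.Ioo (t₀ / 2) (Real.exp (-1) / ek) with hs
  have ht₀s : t₀ ∈ s := ⟨by linarith, by rwa [lt_div_iff₀ hek]⟩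
  have hsn : s ∈ 𝓝 t₀ := isOpen_Ioo.mem_nhds ht₀s
  have hs_pos : ∀ x ∈ s, 0 < x := fun x hx => by linarith [hx.1]
  have hs_le : ∀ x ∈ s, x * ek ≤ Real.exp (-1) := fun x hx => by
    have := hx.2; rw [lt_div_iff₀ hek] at this; exact this.le
  have hlt1 : ∀ x : ℝ, x * ek ≤ Real.exp (-1) → x * ek < 1 := fun x hx =>
    hx.trans_lt (by rw [← Real.exp_zero]; exact Real.exp_lt_exp.mpr (by norm_num))
  obtain ⟨C, hC1, hC⟩ := BIJ88GaussIntegration309Product.abs_iteratedDeriv_prod_cutoff_t_le (ι := ι) χ p (n + 1)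
  set K : ℝ := ((B.card : ℝ) * C) ^ (n + 1) * (t₀ / 2)⁻¹ ^ (n + 1) with hK
  set F : ℝ → Ω → ℝ := fun x ω => iteratedDeriv n (fun s => ∏ b ∈ B, cutoff χ (c b * pLog p (s * ek)) (Φ b ω)) x with hF
  set F' : ℝ → Ω → ℝ := fun x ω => iteratedDeriv (n + 1) (fun s => ∏ b ∈ B, cutoff χ (c b * pLog p (s * ek)) (Φ b ω)) x
    with hF'
  have hzpow : ∀ (x : ℝ) (m : ℕ), x ^ (-(m : ℤ)) = x⁻¹ ^ m := fun x m => by rw [zpow_neg, zpow_natCast, inv_pow]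
  refine hasDerivAt_integral_of_dominated_loc_of_deriv_le (F := F) (F' := F') (bound := fun _ => K) hsn ?_ ?_ ?_ ?_ ?_ ?_
  · exact Filter.eventually_of_mem hsn fun x hx =>
      (measurable_iteratedDeriv_prod_cutoff_t χ p B hΦ c hek n (hs_pos x hx) (hlt1 x (hs_le x hx))).aestronglyMeasurable
  · refine (integrable_const (((B.card : ℝ) * C) ^ n * t₀⁻¹ ^ n)).mono'
      (measurable_iteratedDeriv_prod_cutoff_t χ p B hΦ c hek n ht₀ (hlt1 t₀ h1.le)).aestronglyMeasurable ?_
    refine Filter.Eventually.of_forall fun ω => ?_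
    rw [Real.norm_eq_abs, hF, ← hzpow]
    exact hC B (fun b => Φ b ω) c hc hek ht₀ h1.le n (Nat.le_succ n)
  · exact (measurable_iteratedDeriv_prod_cutoff_t χ p B hΦ c hek (n + 1) ht₀ (hlt1 t₀ h1.le)).aestronglyMeasurable
  · refine Filter.Eventually.of_forall fun ω x hx => ?_
    have h := hC B (fun b => Φ b ω) c hc hek (hs_pos x hx) (hs_le x hx) (n + 1) le_rfl
    rw [Real.norm_eq_abs, hF']
    refine h.trans ?_
    rw [hK, hzpow]
    have hx0 : 0 < x := hs_pos x hx
    have hxinv : x⁻¹ ≤ (t₀ / 2)⁻¹ := by rw [inv_le_inv₀ hx0 (by linarith)]; exact hx.1.le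
    exact mul_le_mul_of_nonneg_left (pow_le_pow_left₀ (inv_nonneg.mpr hx0.le) hxinv _)
      (pow_nonneg (mul_nonneg (Nat.cast_nonneg _) (by linarith)) _)
  · exact integrable_const K
  · exact Filter.Eventually.of_forall fun ω x hx =>
      hasDerivAt_iteratedDeriv_prod_cutoff_t χ p B (fun b => Φ b ω) c hek (hs_pos x hx) (hlt1 x (hs_le x hx)) n

/-- **`z^{(n)}(t₀) = ∫ (d/dt)ⁿχ′_{Λ,t}|_{t₀} dμ` for every `n`** on the branch (induction on `n`; the branch is open, so the n-th
derivative of `z` near `t₀` is the expectation of the n-th derivative, and one more derivative passes under the integral).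
[cite: BalabanImbrieJaffe1988, (5.14.3) p.309] -/
theorem iteratedDeriv_integral_prod_cutoff_t (p : ℝ) (μ : Measure Ω) [IsFiniteMeasure μ] (B : Finset ι) {Φ : ι → Ω → ℝ}
    (hΦ : ∀ b ∈ B, Measurable (Φ b)) {c : ι → ℝ} (hc : ∀ b ∈ B, c b ≠ 0) {ek : ℝ} (hek : 0 < ek) (n : ℕ) {t₀ : ℝ}
    (ht₀ : 0 < t₀) (h1 : t₀ * ek < Real.exp (-1)) :
    iteratedDeriv n (fun t => ∫ ω, ∏ b ∈ B, cutoff χ (c b * pLog p (t * ek)) (Φ b ω) ∂μ) t₀ =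
      ∫ ω, iteratedDeriv n (fun s => ∏ b ∈ B, cutoff χ (c b * pLog p (s * ek)) (Φ b ω)) t₀ ∂μ := by
  induction n generalizing t₀ with
  | zero => simp only [iteratedDeriv_zero]
  | succ n ih =>
    rw [iteratedDeriv_succ]
    have hev : iteratedDeriv n (fun t => ∫ ω, ∏ b ∈ B, cutoff χ (c b * pLog p (t * ek)) (Φ b ω) ∂μ) =ᶠ[𝓝 t₀]
        fun t => ∫ ω, iteratedDeriv n (fun s => ∏ b ∈ B, cutoff χ (c b * pLog p (s * ek)) (Φ b ω)) t ∂μ := by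
      have hmem : Set.Ioo 0 (Real.exp (-1) / ek) ∈ 𝓝 t₀ := isOpen_Ioo.mem_nhds ⟨ht₀, by rwa [lt_div_iff₀ hek]⟩
      filter_upwards [hmem] with t ht
      exact ih ht.1 (by rw [← lt_div_iff₀ hek]; exact ht.2)
    rw [hev.deriv_eq]
    exact (hasDerivAt_integral_iteratedDeriv_prod_cutoff_t χ p μ B hΦ hc hek ht₀ h1 n).2.deriv

/-- **Bound on every derivative of the expectation**: for `n₀` there is `Ĉ = Ĉ(χ,p,n₀) ≥ 1` such that for `1 ≤ n ≤ n₀` on the branch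
`|z^{(n)}(t₀)| ≤ (NĈ)ⁿ·t₀^{−n}·Σ_{b∈B} μ{(9/10)|c_b|p(t₀e_k) ≤ |Φ_b|}`. [cite: BalabanImbrieJaffe1988, (5.14.4) p.309] -/
theorem abs_iteratedDeriv_integral_prod_cutoff_t_le (p : ℝ) (n₀ : ℕ) :
    ∃ C : ℝ, 1 ≤ C ∧ ∀ (μ : Measure Ω) [IsFiniteMeasure μ] (B : Finset ι) (Φ : ι → Ω → ℝ) (c : ι → ℝ),
      (∀ b ∈ B, Measurable (Φ b)) → (∀ b ∈ B, c b ≠ 0) → ∀ ⦃ek t₀ : ℝ⦄, 0 < ek → 0 < t₀ → t₀ * ek < Real.exp (-1) →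
        ∀ n, 1 ≤ n → n ≤ n₀ →
          |iteratedDeriv n (fun t => ∫ ω, ∏ b ∈ B, cutoff χ (c b * pLog p (t * ek)) (Φ b ω) ∂μ) t₀| ≤
            ((B.card : ℝ) * C) ^ n * t₀ ^ (-(n : ℤ)) * ∑ b ∈ B, μ.real {ω | 9 / 10 * (|c b| * pLog p (t₀ * ek)) ≤ |Φ b ω|} := by
  obtain ⟨C, hC1, hC⟩ :=
    BIJ88GaussIntegration309Product.integral_abs_iteratedDeriv_prod_cutoff_t_le_measureReal (ι := ι) (Ω := Ω) χ p n₀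
  refine ⟨C, hC1, ?_⟩
  intro μ _ B Φ c hΦ hc ek t₀ hek ht₀ h1 n hn1 hn
  rw [iteratedDeriv_integral_prod_cutoff_t χ p μ B hΦ hc hek n ht₀ h1]
  exact (abs_integral_le_integral_abs).trans (hC μ B Φ c hΦ hc hek ht₀ h1.le n hn1 hn)

end UnderIntegral

/-! ## §4 Gaussian marginals: the restrictions disappear at `t = 0` to all orders -/

section Gaussian

variable (χ : CutoffProfile) {ι Ω : Type*} [MeasurableSpace Ω]

/-- **Every derivative of `z` carries the Gaussian factor**: with CENTERED Gaussian marginals of variances `≤ v`, `|c_b| ≥ c₀ > 0`,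
`|z^{(n)}(t₀)| ≤ (NĈ)ⁿ t₀^{−n} · 2N · e^{−(81/200)(c₀²/v)p(t₀e_k)²}` for `1 ≤ n ≤ n₀`. [cite: BalabanImbrieJaffe1988, (5.14.4) p.309] -/
theorem abs_iteratedDeriv_integral_prod_cutoff_t_le_of_hasGaussianLaw (p : ℝ) (n₀ : ℕ) :
    ∃ C : ℝ, 1 ≤ C ∧ ∀ (P : Measure Ω) [IsProbabilityMeasure P] (B : Finset ι) (Φ : ι → Ω → ℝ) (c : ι → ℝ) (c₀ v : ℝ),
      (∀ b ∈ B, HasGaussianLaw (Φ b) P) → (∀ b ∈ B, Measurable (Φ b)) → (∀ b ∈ B, P[Φ b] = 0) →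
      0 < v → (∀ b ∈ B, Var[Φ b; P] ≤ v) → 0 < c₀ → (∀ b ∈ B, c₀ ≤ |c b|) →
      ∀ ⦃ek t₀ : ℝ⦄, 0 < ek → 0 < t₀ → t₀ * ek < Real.exp (-1) → ∀ n, 1 ≤ n → n ≤ n₀ →
        |iteratedDeriv n (fun t => ∫ ω, ∏ b ∈ B, cutoff χ (c b * pLog p (t * ek)) (Φ b ω) ∂P) t₀| ≤
          ((B.card : ℝ) * C) ^ n * t₀ ^ (-(n : ℤ)) *
            (2 * B.card * Real.exp (-(81 / 200 * (c₀ ^ 2 / v) * pLog p (t₀ * ek) ^ 2))) := by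
  obtain ⟨C, hC1, hC⟩ :=
    BIJ88GaussIntegration309Law.integral_abs_iteratedDeriv_prod_cutoff_t_le_of_hasGaussianLaw (ι := ι) (Ω := Ω) χ p n₀
  refine ⟨C, hC1, ?_⟩
  intro P _ B Φ c c₀ v hG hΦ h0 hv hvar hc₀ hcb ek t₀ hek ht₀ h1 n hn1 hn
  have hcne : ∀ b ∈ B, c b ≠ 0 := fun b hb h => by
    have := hcb b hb; rw [h, abs_zero] at this; linarith
  rw [iteratedDeriv_integral_prod_cutoff_t χ p P B hΦ hcne hek n ht₀ h1]
  exact (abs_integral_le_integral_abs).trans (hC P B Φ c c₀ v hG hΦ h0 hv hvar hc₀ hcb hek ht₀ h1.le n hn1 hn)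

/-- The Gaussian factor beats every power of `t`: for `κ > 0`, `p > 1/2`, `e_k > 0` and every `n`,
`t^{−n}·e^{−κ·p(te_k)²} → 0` as `t → 0⁺` (for small `t`, `e^{−κp(te_k)²} ≤ (te_k)^{n+1}` by the standing bookkeeping of
`BIJ88GaussFactor309.exp_pLog_sq_le_pow`). [cite: BalabanImbrieJaffe1988, p.309 (Sect. 5.14)] -/
theorem tendsto_zpow_mul_exp_neg_pLog_sq {κ p ek : ℝ} (hκ : 0 < κ) (hp : 1 / 2 < p) (hek : 0 < ek) (n : ℕ) :
    Tendsto (fun t : ℝ => t ^ (-(n : ℤ)) * Real.exp (-(κ * pLog p (t * ek) ^ 2))) (𝓝[>] (0 : ℝ)) (𝓝 0) := by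
  -- x = t·e_k → 0⁺, log x⁻¹ → +∞, so the regime (n+1) ≤ κ (log x⁻¹)^{2p−1} holds eventually
  have hx : Tendsto (fun t : ℝ => t * ek) (𝓝[>] (0 : ℝ)) (𝓝[>] (0 : ℝ)) := by
    refine tendsto_nhdsWithin_iff.mpr ⟨?_, ?_⟩
    · have : Tendsto (fun t : ℝ => t * ek) (𝓝 0) (𝓝 (0 * ek)) := tendsto_id.mul_const ek
      rw [zero_mul] at this
      exact this.mono_left nhdsWithin_le_nhds
    · exact eventually_nhdsWithin_of_forall fun t ht => mul_pos ht hek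
  have hlog : Tendsto (fun t : ℝ => Real.log (t * ek)⁻¹) (𝓝[>] (0 : ℝ)) atTop := by
    have h := Real.tendsto_log_nhdsGT_zero.comp hx
    have h' := tendsto_neg_atBot_atTop.comp h
    refine h'.congr fun t => ?_
    rw [Function.comp_apply, Function.comp_apply, Real.log_inv]
  have hreg : ∀ᶠ t in 𝓝[>] (0 : ℝ), ((n : ℝ) + 1) / κ ≤ Real.log (t * ek)⁻¹ ^ (2 * p - 1) :=
    ((tendsto_rpow_atTop (by linarith : (0 : ℝ) < 2 * p - 1)).comp hlog).eventually_ge_atTop _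
  have hsmall : ∀ᶠ t in 𝓝[>] (0 : ℝ), t * ek ≤ 1 := by
    have : Tendsto (fun t : ℝ => t * ek) (𝓝[>] (0 : ℝ)) (𝓝 0) := hx.mono_right nhdsWithin_le_nhds
    exact (this.eventually (ge_mem_nhds zero_lt_one))
  have hpos : ∀ᶠ t in 𝓝[>] (0 : ℝ), (0 : ℝ) < t := eventually_nhdsWithin_of_forall fun t ht => ht
  -- squeeze between 0 and t·e_k^{n+1}
  have hupper : ∀ᶠ t in 𝓝[>] (0 : ℝ), t ^ (-(n : ℤ)) * Real.exp (-(κ * pLog p (t * ek) ^ 2)) ≤ t * ek ^ (n + 1) := by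
    filter_upwards [hreg, hsmall, hpos] with t ht h1 ht0
    have htek : 0 < t * ek := mul_pos ht0 hek
    have hreg' : (n : ℝ) + 1 ≤ κ * Real.log (t * ek)⁻¹ ^ (2 * p - 1) := by
      rw [div_le_iff₀ hκ] at ht; linarith
    have h := BIJ88GaussFactor309.exp_pLog_sq_le_pow (x := t * ek) (ek := t * ek) (c := κ) (p := p) (n := n) htek le_rfl h1
      hp hκ.le hreg'
    have hz : 0 < t ^ (-(n : ℤ)) := zpow_pos ht0 _
    calc t ^ (-(n : ℤ)) * Real.exp (-(κ * pLog p (t * ek) ^ 2)) ≤ t ^ (-(n : ℤ)) * (t * ek) ^ (n + 1) :=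
          mul_le_mul_of_nonneg_left h hz.le
      _ = t * ek ^ (n + 1) := by
          rw [mul_pow, zpow_neg, zpow_natCast, pow_succ]
          field_simp
  have hlower : ∀ᶠ t in 𝓝[>] (0 : ℝ), 0 ≤ t ^ (-(n : ℤ)) * Real.exp (-(κ * pLog p (t * ek) ^ 2)) := by
    filter_upwards [hpos] with t ht0
    exact mul_nonneg (zpow_pos ht0 _).le (Real.exp_pos _).le
  have hlim : Tendsto (fun t : ℝ => t * ek ^ (n + 1)) (𝓝[>] (0 : ℝ)) (𝓝 0) := by
    have : Tendsto (fun t : ℝ => t * ek ^ (n + 1)) (𝓝 0) (𝓝 (0 * ek ^ (n + 1))) := tendsto_id.mul_const _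
    rw [zero_mul] at this
    exact this.mono_left nhdsWithin_le_nhds
  exact squeeze_zero' hlower hupper hlim

/-- **The restrictions disappear at `t = 0` to all orders.**  With CENTERED Gaussian marginals (variances `≤ v`, `0 < v`), thresholds
`|c_b| ≥ c₀ > 0`, exponent `p > 1/2` and `e_k > 0`: for every `n ≥ 1`, `z^{(n)}(t) → 0` as `t → 0⁺` — the restriction factor `⟨χ′_{Λ,t}⟩`
has vanishing Taylor coefficients at `t = 0⁺` (*"extremely small factors when a χ′-factor is replaced by 1"*, p. 307).
[cite: BalabanImbrieJaffe1988, (5.14.2) p.308] -/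
theorem tendsto_iteratedDeriv_integral_prod_cutoff_t_zero {p : ℝ} (hp : 1 / 2 < p) (P : Measure Ω) [IsProbabilityMeasure P]
    (B : Finset ι) {Φ : ι → Ω → ℝ} (hG : ∀ b ∈ B, HasGaussianLaw (Φ b) P) (hΦ : ∀ b ∈ B, Measurable (Φ b))
    (h0 : ∀ b ∈ B, P[Φ b] = 0) {v : ℝ} (hv : 0 < v) (hvar : ∀ b ∈ B, Var[Φ b; P] ≤ v) {c : ι → ℝ} {c₀ : ℝ} (hc₀ : 0 < c₀)
    (hcb : ∀ b ∈ B, c₀ ≤ |c b|) {ek : ℝ} (hek : 0 < ek) {n : ℕ} (hn : 1 ≤ n) :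
    Tendsto (fun t => iteratedDeriv n (fun t => ∫ ω, ∏ b ∈ B, cutoff χ (c b * pLog p (t * ek)) (Φ b ω) ∂P) t)
      (𝓝[>] (0 : ℝ)) (𝓝 0) := by
  obtain ⟨C, hC1, hC⟩ := abs_iteratedDeriv_integral_prod_cutoff_t_le_of_hasGaussianLaw (ι := ι) (Ω := Ω) χ p n
  have hκ : 0 < 81 / 200 * (c₀ ^ 2 / v) := by positivity
  -- the bound holds for t on the branch (0, e^{−1}/e_k), which is a neighbourhood of 0⁺
  have hbranch : ∀ᶠ t in 𝓝[>] (0 : ℝ), t * ek < Real.exp (-1) := by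
    have : Tendsto (fun t : ℝ => t * ek) (𝓝[>] (0 : ℝ)) (𝓝 0) := by
      have h := (tendsto_id.mul_const ek : Tendsto (fun t : ℝ => t * ek) (𝓝 0) (𝓝 (0 * ek)))
      rw [zero_mul] at h
      exact h.mono_left nhdsWithin_le_nhds
    exact this.eventually (gt_mem_nhds (Real.exp_pos _))
  have hpos : ∀ᶠ t in 𝓝[>] (0 : ℝ), (0 : ℝ) < t := eventually_nhdsWithin_of_forall fun t ht => ht
  refine squeeze_zero_norm' (a := fun t => ((B.card : ℝ) * C) ^ n * (2 * B.card) *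
      (t ^ (-(n : ℤ)) * Real.exp (-(81 / 200 * (c₀ ^ 2 / v) * pLog p (t * ek) ^ 2)))) ?_ ?_
  · filter_upwards [hbranch, hpos] with t h1 ht0
    rw [Real.norm_eq_abs]
    refine (hC P B Φ c c₀ v hG hΦ h0 hv hvar hc₀ hcb hek ht0 h1 n hn le_rfl).trans (le_of_eq ?_)
    ring
  · have h := (tendsto_zpow_mul_exp_neg_pLog_sq hκ hp hek n).const_mul (((B.card : ℝ) * C) ^ n * (2 * B.card))
    rw [mul_zero] at h
    exact h

end Gaussian

end Literature.MathematicalPhysics.QuantumFieldTheory.BalabanImbrieJaffe1984to88.BIJ88RestrictionsAllOrders308
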